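import Mathlib
import HarnessLib
import Summits.ResolutionOfSingularities.ResolutionOfSingularities.Theses.SyzygyFlattening

/-!
# The syzygy-flattening tower of route `SyzygyFlattening` — named vocabulary (definitions only)

Every item of the route `ResolutionOfSingularities/SyzygyFlattening` (`RankOneTermination`,
`HigherRankTermination`, `Globalisation`, `DimZeroSuffices`, `NoStall`, `SurfaceTermination`)
states its conclusion over ONE `let`-bound chain `n, J, loc, chart, nrm, tower` (character for
character the same in all six items). This file gives those `let`-bound terms NAMES, so that
prover files under `Theorems/` can state lemmas about single stages of the tower, and proves —
by `rfl` / `Iff.rfl` only — that the names ARE the route's terms: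

* `singIdeal B` (`J B`): the intersection of the primes `𝔭` of `B` with `B_𝔭` not regular (the
  radical ideal of the non-regular locus);
* `locAt O B` (`loc B`): `B` with the inverses of its `O`-units adjoined — for `B ⊆ O` this is the
  local ring of `B` at the centre `𝔪_O ∩ B` of the valuation, realised inside `K`;
* `syzygyIndex k K` (`n`): `tr.deg_k K` as a natural number;
* `chartSet O B`, `chart O B` (`chart B`): `B` with the `O`-minimal affine charts of the blow-up
  of the ideal of maximal minors of (an embedding of) the `n`-th syzygy module of `B ⧸ J B`
  adjoined (all free resolutions, embeddings and minimal minors at once);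
* `nrm B`: the integral closure of `B` in `K`, as a `k`-subalgebra;
* `step O B = locAt O (nrm (chart O B))` and `tower O A m` (`T₀ = locAt O A`,
  `T_{m+1} = step O (T_m)`), `TowerTerminates O A := ∃ m, IsRegularLocalRing (tower O A m)`.

Plus the recurring hypotheses by name: `DimZero k O` (residue field of `O` algebraic over `k`),
`TwoOverrings O` (rank ≤ 1: the only overrings are `O` and `K`), `RankOneInput p` (the
antecedent of `HigherRankTermination` at `p` = `RankOneTermination` at `p`), `EssFiniteType B`
(`B` is a localisation of a finitely generated `k`-subalgebra of `K`), `RegularAlong O₁ B`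
(`locAt O₁ B` is a regular local ring) and `EventuallyRegularAlong O A O₁`.

The bridges `rankOneTermination_iff`, `higherRankTermination_iff`, `dimZeroSuffices_iff`,
`noStall_iff`, `surfaceTermination_iff`, `globalisation_iff` are `Iff.rfl`: nothing is
restated, only named. No mathematics is claimed in this file.

Sources for the objects: the route header (Theses/SyzygyFlattening.lean); the Nash transform /
flattening of a module by blowing up its ideal of maximal minors [OnetoZatini1991;
Villamayor2006Flattening]; syzygy modules up to free summands [Eisenbud1980]; rank and
dimension of valuations [ZariskiSamuel1960, VI §§3, 10].
-/

noncomputable section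

-- single-problem summit: the doubled namespace component `ResolutionOfSingularities` is forced
set_option linter.dupNamespace false

namespace Summit.ResolutionOfSingularities.ResolutionOfSingularities.Theorems.SyzygyFlattening

open Summit.ResolutionOfSingularities.ResolutionOfSingularities.Theses.SyzygyFlattening

variable {k K : Type} [Field k] [Field K] [Algebra k K]

/-! ## The operator, piece by piece -/

/-- **The ideal of the non-regular locus** `J B`: the intersection of the prime ideals `𝔭` of `B`
whose localisation `B_𝔭` is not a regular local ring (so `J B = ⊤` iff `B` is a regular ring).
Verbatim the route's `let J`. [folklore] -/
def singIdeal (B : Subalgebra k K) : Ideal ↥B :=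
  sInf ((fun 𝔭 : PrimeSpectrum ↥B => 𝔭.asIdeal) ''
    {𝔭 : PrimeSpectrum ↥B | ¬ IsRegularLocalRing (Localization.AtPrime 𝔭.asIdeal)})

/-- **Localisation at the centre of a valuation, inside `K`** (`loc B`): the `k`-subalgebra
generated by the fractions `a * s⁻¹` with `a, s ∈ B` and `s⁻¹ ∈ O`. For `B ⊆ O` the admissible
denominators are exactly the `O`-units of `B` (and `s = 0`, contributing `0`), so this is
`B_{𝔪_O ∩ B}` realised in `K`. Verbatim the route's `let loc`. [folklore] -/
def locAt (O : ValuationSubring K) (B : Subalgebra k K) : Subalgebra k K :=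
  Algebra.adjoin k {y : K | ∃ a ∈ B, ∃ s ∈ B, s⁻¹ ∈ O ∧ y = a * s⁻¹}

variable (k K) in
/-- **The syzygy index** `n = tr.deg_k K` (as a natural number; `K/k` is finitely generated in
every item, so nothing is lost): the operator flattens the `n`-TH syzygy module of the
non-regular locus. Verbatim the route's `let n`. [folklore] -/
def syzygyIndex : ℕ :=
  Cardinal.toNat (Algebra.trdeg k K)

/-- **The Plücker ratios adjoined by one step** (`chartSet O B`): every ratio
`det (ι g) / det (ι x)` where `(b, d, ε)` runs over the free resolutions
`⋯ → B^{b 1} → B^{b 0} → B ⧸ J B → 0` of `B ⧸ J B` by finite free `B`-modules, `ι` over the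
embeddings with torsion cokernel of the `n`-th syzygy module `range (d (n-1))`
(`n = syzygyIndex k K`) into a finite free module `B^r`, and `g, x` over `r`-tuples of
syzygies with `det (ι x) ≠ 0` and `x` `O`-MINIMAL (`det (ι g') / det (ι x) ∈ O` for every
`g'`). Verbatim the set-builder of the route's `let chart`, with `J` and `n` by name.
[cite: OnetoZatini1991, §1 (Nash transformation of a module)] -/
def chartSet (O : ValuationSubring K) (B : Subalgebra k K) : Set K :=
  {y : K | ∃ (b : ℕ → ℕ) (d : (i : ℕ) → ((Fin (b (i + 1)) → ↥B) →ₗ[↥B] (Fin (b i) → ↥B))) (ε : (Fin (b 0) → ↥B) →ₗ[↥B] (↥B ⧸ singIdeal B)) (r : ℕ) (ι : ↥(LinearMap.range (d (syzygyIndex k K - 1))) →ₗ[↥B] (Fin r → ↥B)), Function.Surjective ε ∧ Function.Exact (d 0) ε ∧ (∀ i : ℕ, Function.Exact (d (i + 1)) (d i)) ∧ Function.Injective ι ∧ (∀ z : Fin r → ↥B, ∃ a : ↥B, a ≠ 0 ∧ a • z ∈ LinearMap.range ι) ∧ ∃ g x : Fin r → ↥(LinearMap.range (d (syzygyIndex k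 K - 1))), Matrix.det (Matrix.of fun i j => ((ι (x i) j : ↥B) : K)) ≠ 0 ∧ (∀ g' : Fin r → ↥(LinearMap.range (d (syzygyIndex k K - 1))), Matrix.det (Matrix.of fun i j => ((ι (g' i) j : ↥B) : K)) * (Matrix.det (Matrix.of fun i j => ((ι (x i) j : ↥B) : K)))⁻¹ ∈ O) ∧ y = Matrix.det (Matrix.of fun i j => ((ι (g i) j : ↥B) : K)) * (Matrix.det (Matrix.of fun i j => ((ι (x i) j : ↥B) : K)))⁻¹}

/-- **The syzygy-flattening chart** (`chart B`): `B` with all the Plücker ratios `chartSet O B`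
adjoined — the union of the `O`-minimal affine charts of the blow-up of the ideal of maximal
minors of the `n`-th syzygy module of `B ⧸ J B` (the flattening / Nash transform of that
module), over all resolutions and embeddings at once. Verbatim the route's `let chart` with
`J`, `n` by name (Oneto–Zatini 1991; Villamayor 2006; Eisenbud 1980).
[cite: Villamayor2006Flattening, Thm. 1.1 (flattening by blowing up)] -/
def chart (O : ValuationSubring K) (B : Subalgebra k K) : Subalgebra k K :=
  Algebra.adjoin k ((B : Set K) ∪ chartSet O B)

/-- **Normalisation inside `K`** (`nrm B`): the `k`-subalgebra generated by the elements of `K`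
integral over `B` (= the integral closure of `B` in `K`). Verbatim the route's `let nrm`.
[folklore] -/
def nrm (B : Subalgebra k K) : Subalgebra k K :=
  Algebra.adjoin k {y : K | IsIntegral ↥B y}

/-- **One step of the operator along `O`**: `step O B = locAt O (nrm (chart O B))` — blow up the
ideal of maximal minors of the top syzygy of the non-regular locus (minimal chart), normalise,
localise at the centre of the valuation. [cite: Villamayor2006Flattening, Thm. 1.1 (flattening by blowing up)] -/
def step (O : ValuationSubring K) (B : Subalgebra k K) : Subalgebra k K :=
  locAt O (nrm (chart O B))

/-- **The syzygy-flattening tower along `O` started at `A`**: `tower O A 0 = locAt O A` and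
`tower O A (m+1) = step O (tower O A m)`. Verbatim (up to the names above) the route's
`let tower`, so that `towerTerminates_iff` below is `Iff.rfl`. [cite: Eisenbud1980, §5 (syzygies over hypersurfaces)] -/
def tower (O : ValuationSubring K) (A : Subalgebra k K) (m : ℕ) : Subalgebra k K :=
  @Nat.rec (fun _ => Subalgebra k K) (locAt O A) (fun _ B => locAt O (nrm (chart O B))) m

/-- **Termination of the tower along `O` from `A`**: some stage is a regular local ring — the
conclusion of every item of the route. [folklore] -/
def TowerTerminates (O : ValuationSubring K) (A : Subalgebra k K) : Prop :=
  ∃ m : ℕ, IsRegularLocalRing ↥(tower O A m)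

/-! ## The recurring hypotheses, by name -/

variable (k) in
/-- **Dimension zero**: every `y ∈ O` is, modulo `𝔪_O`, a root of a non-zero polynomial over `k`
(the residue field of `O` is algebraic over `k`). Verbatim the route's binder.
[cite: ZariskiSamuel1960, VI §3] -/
def DimZero (O : ValuationSubring K) : Prop :=
  ∀ y : K, y ∈ O → ∃ f : Polynomial k, f ≠ 0 ∧ O.valuation (Polynomial.aeval y f) < 1

/-- **Rank at most one**: the only valuation subrings of `K` containing `O` are `O` and `K`
(for `O ≠ ⊤` this is `ringKrullDim O = 1`; `O = ⊤` is the trivial valuation).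
[cite: ZariskiSamuel1960, VI §10] -/
def TwoOverrings (O : ValuationSubring K) : Prop :=
  ∀ S : ValuationSubring K, O ≤ S → S = O ∨ S = ⊤

/-- **The crux hypothesis `RankOneTermination` at the prime `p`**, by name: termination along
every rank-one (`ringKrullDim O = 1`), dimension-zero valuation ring `O ⊇ k` of `K = Frac A`,
`A ⊆ O` finitely generated, over every field `k` of characteristic `p`. Definitionally the
antecedent of `HigherRankTermination` at `p` (`higherRankTermination_iff`). [folklore] -/
def RankOneInput (p : ℕ) : Prop :=
  ∀ (k K : Type) [Field k] [CharP k p] [Field K] [Algebra k K] (O : ValuationSubring K)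
    (A : Subalgebra k K), (∀ c : k, algebraMap k K c ∈ O) → A.FG → IsFractionRing ↥A K →
    A.toSubring ≤ O.toSubring → DimZero k O → ringKrullDim ↥O = 1 → TowerTerminates O A

/-- **Essentially of finite type inside `K`**: `B` is a localisation of a finitely generated
`k`-subalgebra `C ≤ B` of `K` — every element of `B` is `c * s⁻¹` with `c, s ∈ C` and
`s⁻¹ ∈ B`. (The stages of the tower are of this kind, never finitely generated themselves.)
[folklore] -/
def EssFiniteType (B : Subalgebra k K) : Prop :=
  ∃ C : Subalgebra k K, C ≤ B ∧ C.FG ∧ ∀ b ∈ B, ∃ c ∈ C, ∃ s ∈ C, s⁻¹ ∈ B ∧ b = c * s⁻¹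

/-- **Regularity of `B` at the centre of the valuation ring `O₁`**: the localisation
`locAt O₁ B` of `B` at the centre of `O₁`, realised in `K`, is a regular local ring.
[cite: NovacoskiSpivakovsky2014, Def. 2.20] -/
def RegularAlong (O₁ : ValuationSubring K) (B : Subalgebra k K) : Prop :=
  IsRegularLocalRing ↥(locAt O₁ B)

/-- **Eventual, persistent regularity of the `O`-tower at the centre of a coarsening `O₁`**:
from some stage on every `tower O A m` is regular at the centre of `O₁`.
[cite: NovacoskiSpivakovsky2014, Cor. 2.14 (the existential shadow)] -/
def EventuallyRegularAlong (O : ValuationSubring K) (A : Subalgebra k K)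
    (O₁ : ValuationSubring K) : Prop :=
  ∃ m₀ : ℕ, ∀ m : ℕ, m₀ ≤ m → RegularAlong O₁ (tower O A m)

/-! ## The names are the route's terms (definitional bridges, `rfl` only) -/

section
variable (O : ValuationSubring K) (A B : Subalgebra k K)

/-- Stage `0` is the localisation of `A` at the centre. [folklore] -/
@[simp] theorem tower_zero : tower O A 0 = locAt O A := rfl

/-- Stage `m+1` is the operator applied to stage `m`. [folklore] -/
theorem tower_succ (m : ℕ) : tower O A (m + 1) = locAt O (nrm (chart O (tower O A m))) := rfl

/-- Stage `m+1` is `step O` of stage `m`. [folklore] -/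
@[simp] theorem tower_succ' (m : ℕ) : tower O A (m + 1) = step O (tower O A m) := rfl

/-- **Registered glue stub `stub_towerVocabulary`** (crux stmt-ResolutionOfSingularities-17045,
line `birth`): the tower is the iteration of `step` — the definitional fact under which this
vocabulary file lands; the reshaped skeleton states every stub through these names. [folklore] -/
theorem stub_towerVocabulary : ∀ (O : ValuationSubring K) (A : Subalgebra k K) (m : ℕ), tower O A 0 = locAt O A ∧ tower O A (m + 1) = step O (tower O A m) :=
  fun _ _ _ => ⟨rfl, rfl⟩

/-- `chart` unfolds to `adjoin (B ∪ chartSet O B)`. [folklore] -/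
theorem chart_def : chart O B = Algebra.adjoin k ((B : Set K) ∪ chartSet O B) := rfl

/-- `step` unfolds to `locAt ∘ nrm ∘ chart`. [folklore] -/
theorem step_def : step O B = locAt O (nrm (chart O B)) := rfl

/-- `RegularAlong` unfolds. [folklore] -/
theorem regularAlong_iff (O₁ : ValuationSubring K) :
    RegularAlong O₁ B ↔ IsRegularLocalRing ↥(locAt O₁ B) := Iff.rfl

/-- **`TowerTerminates O A` is, on the nose, the route's `let`-bound conclusion**
`let n …; let J …; let loc …; let chart …; let nrm …; let tower …; ∃ m, IsRegularLocalRing ↥(tower A m)`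
(ζ/δ-reduction only). [folklore] -/
theorem towerTerminates_iff :
    TowerTerminates O A ↔
      (let n : ℕ := Cardinal.toNat (Algebra.trdeg k K); let J : (B : Subalgebra k K) → Ideal ↥B := fun B => sInf ((fun 𝔭 : PrimeSpectrum ↥B => 𝔭.asIdeal) '' {𝔭 : PrimeSpectrum ↥B | ¬ IsRegularLocalRing (Localization.AtPrime 𝔭.asIdeal)}); let loc : Subalgebra k K → Subalgebra k K := fun B => Algebra.adjoin k {y : K | ∃ a ∈ B, ∃ s ∈ B, s⁻¹ ∈ O ∧ y = a * s⁻¹}; let chart : Subalgebra k K → Subalgebra k K := fun B => Algebra.adjoin k ((B : Set K) ∪ {y : K | ∃ (b : ℕ → ℕ) (d : (i : ℕ) → ((Fin (b (i + 1)) → ↥B) →ₗ[↥B] (Fin (b i) → ↥B))) (ε : (Fin (b 0) → ↥B) →ₗ[↥B] (↥B ⧸ J B)) (r : ℕ) (ι : ↥(LinearMap.range (d (n - 1))) →ₗ[↥B] (Fin r → ↥B)), Function.Surjective ε ∧ Function.Exact (d 0) ε ∧ (∀ i : ℕ, Function.Exact (d (i + 1)) (d i)) ∧ Function.Injective ι ∧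 (∀ z : Fin r → ↥B, ∃ a : ↥B, a ≠ 0 ∧ a • z ∈ LinearMap.range ι) ∧ ∃ g x : Fin r → ↥(LinearMap.range (d (n - 1))), Matrix.det (Matrix.of fun i j => ((ι (x i) j : ↥B) : K)) ≠ 0 ∧ (∀ g' : Fin r → ↥(LinearMap.range (d (n - 1))), Matrix.det (Matrix.of fun i j => ((ι (g' i) j : ↥B) : K)) * (Matrix.det (Matrix.of fun i j => ((ι (x i) j : ↥B) : K)))⁻¹ ∈ O) ∧ y = Matrix.det (Matrix.of fun i j => ((ι (g i) j : ↥B) : K)) * (Matrix.det (Matrix.of fun i j => ((ι (x i) j : ↥B) : K)))⁻¹}); let nrm : Subalgebra k K → Subalgebra k K := fun B => Algebra.adjoin k {y : K | IsIntegral ↥B y}; let tower : Subalgebra k K → ℕ → Subalgebra k K := fun A m => @Nat.rec (fun _ => Subalgebra k K) (loc A) (fun _ B => loc (nrm (chart B))) m; ∃ m : ℕ, IsRegularLocalRing ↥(tower A m)) :=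
  Iff.rfl

end

/-- `RankOneTermination` by name: `∀ p prime, RankOneInput p`. [folklore] -/
theorem rankOneTermination_iff : RankOneTermination ↔ ∀ p : ℕ, p.Prime → RankOneInput p :=
  Iff.rfl

/-- `HigherRankTermination` by name: at each prime `p`, `RankOneInput p` implies termination
along every dimension-zero valuation. [folklore] -/
theorem higherRankTermination_iff :
    HigherRankTermination ↔
      ∀ p : ℕ, p.Prime → RankOneInput p →
        ∀ (k K : Type) [Field k] [CharP k p] [Field K] [Algebra k K] (O : ValuationSubring K)
          (A : Subalgebra k K), (∀ c : k, algebraMap k K c ∈ O) → A.FG → IsFractionRing ↥A K →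
          A.toSubring ≤ O.toSubring → DimZero k O → TowerTerminates O A :=
  Iff.rfl

/-- `DimZeroSuffices` by name. [folklore] -/
theorem dimZeroSuffices_iff :
    DimZeroSuffices ↔
      ∀ p : ℕ, p.Prime →
        (∀ (k K : Type) [Field k] [CharP k p] [Field K] [Algebra k K] (O : ValuationSubring K)
          (A : Subalgebra k K), (∀ c : k, algebraMap k K c ∈ O) → A.FG → IsFractionRing ↥A K →
          A.toSubring ≤ O.toSubring → DimZero k O → TowerTerminates O A) →
        ∀ (k K : Type) [Field k] [CharP k p] [Field K] [Algebra k K] (O : ValuationSubring K)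
          (A : Subalgebra k K), (∀ c : k, algebraMap k K c ∈ O) → A.FG → IsFractionRing ↥A K →
          A.toSubring ≤ O.toSubring → TowerTerminates O A :=
  Iff.rfl

/-- `NoStall` by name: a stationary stage is regular. [folklore] -/
theorem noStall_iff :
    NoStall ↔
      ∀ p : ℕ, p.Prime → ∀ (k K : Type) [Field k] [CharP k p] [Field K] [Algebra k K]
        (O : ValuationSubring K) (A : Subalgebra k K), (∀ c : k, algebraMap k K c ∈ O) → A.FG →
        IsFractionRing ↥A K → A.toSubring ≤ O.toSubring →
        ∀ m : ℕ, tower O A (m + 1) = tower O A m → IsRegularLocalRing ↥(tower O A m) :=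
  Iff.rfl

/-- `SurfaceTermination` by name. [folklore] -/
theorem surfaceTermination_iff :
    SurfaceTermination ↔
      ∀ p : ℕ, p.Prime → ∀ (k K : Type) [Field k] [CharP k p] [Field K] [Algebra k K]
        (O : ValuationSubring K) (A : Subalgebra k K), (∀ c : k, algebraMap k K c ∈ O) → A.FG →
        IsFractionRing ↥A K → A.toSubring ≤ O.toSubring → ringKrullDim ↥A = 2 →
        TowerTerminates O A :=
  Iff.rfl

/-- `Globalisation` by name. [folklore] -/
theorem globalisation_iff :
    Globalisation ↔
      ∀ p : ℕ, p.Prime →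
        (∀ (k K : Type) [Field k] [CharP k p] [Field K] [Algebra k K] (O : ValuationSubring K)
          (A : Subalgebra k K), (∀ c : k, algebraMap k K c ∈ O) → A.FG → IsFractionRing ↥A K →
          A.toSubring ≤ O.toSubring → DimZero k O → TowerTerminates O A) →
        Literature.AlgebraicGeometry.Resolution.ResolutionInChar.{0} p :=
  Iff.rfl

end Summit.ResolutionOfSingularities.ResolutionOfSingularities.Theorems.SyzygyFlattening

end
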